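import Summits.AnomalousDissipation.AnomalousDissipation.Theorems.SolenoidalFractalHomogenisationLagrangianStepDefs
import Summits.AnomalousDissipation.AnomalousDissipation.Theorems.IsotropicCubatureWord
import Mathlib.Analysis.Normed.Algebra.MatrixExponential

/-!
# K1L `LagrangianRenormalisationStep` (stmt-AnomalousDissipation-24912) — crux idea `loewner-reflected-window`
(planner ad-ideate-p5 gen 3, lens «profile» = profile-and-certify), SKETCH of the typed statements.  Nothing here is proved;
every item elaborates.  Vocabulary: the LANDED shared definitions of the K1L skeleton (p610007,
`…Theorems.SolenoidalFractalHomogenisation.LagrangianStep.{slotWeight, mhat, excShape, TensorCellPackage}`) and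
`Literature.Analysis.FluidPDE.PassiveVectorTensor` (`Torus.Visc4 / symb / bsymb / NearIso / OddSmall / isoVisc`).

THE LEVER.  The window clause of `TensorCellPackage` (first conjunct; `WindowClause` below = the strategist's `Lines/onelevel.lean`
`WindowClause`, verbatim) asks for a normalised large-gain SHAPE MAP `Φ` with a NESTED family of `Φ`-invariant transverse windows
`{OddSmall β} ∩ {NearIso (lo/λ) (hi·λ)}`, `λ ∈ [1, Λ]`.  For the quasi-static cell response of a lattice shear word every slot `s`
contributes `e_s ⊗ e_s ⊗ f_{T_s}(B_s(S))` where `B_s(S) = P_s Σ(S, m̂_s) P_s` is the TRANSVERSE BLOCK of the background shape at the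
layer's wave vector and `f_T(B) = ϑ(T·B)·B⁻¹ = T ∫₀¹∫₀ˢ a(s) a(x) e^{−T(s−x)B} dx ds` (`qsResp`; the frozen model `excShape` replaces
`f_{T_s}(B)` by `ϑ(T_s)·B⁻¹`).  Two exact facts: (i) LOEWNER ORDER-REVERSAL per slot — `f_T` is a non-increasing function
(`f_T(x) = T∫₀¹ e^{−Txu} C_a(u) du`, `C_a ≥ 0` the autocorrelation of the slot envelope) and `x·f_T(x) = ϑ(Tx)` is non-decreasing
(`C_a` is non-increasing), so `a ≤ B_s ≤ b` on `m̂_s^⊥` (which is what `NearIso S a b` says at `k = m̂_s`, the block being symmetric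
by `OddSmall S 0`) pinches `pᵀ f_{T_s}(B_s) p` between `f_{T_s}(b)|P_s p|²` and `f_{T_s}(a)|P_s p|²`; (ii) CUBATURE ISOTROPY of the
leading term — `Σ_s slotGain_s(q,p) = c₀·period·|q|²|p|²` on transverse pairs (`IsotropicWordGain`, tree).  Hence (`QSPinch`)
`gainForm(b; q,p)/b ≤ symb (excQS S) q p ≤ gainForm(a; q,p)/a`, and the window clause for `Φ = N⁻¹·excQS` REDUCES TO ONE
FINITE-DIMENSIONAL INEQUALITY between two explicit quartic forms on the transverse-pair variety (`QSWindow`):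
`gainSup(lo) ≤ N·lo·hi ≤ gainInf(hi)` — for EVERY `Λ ≥ 1`, with `β = 0`, NO smallness, NO linearisation, NO contraction.
Armstrong–Vicol's reflected scalar recursion `κ ↦ κ + c/κ` (Lemma 3.4) is the case of one isotropic slot family.

THE PROFILE (folder `k1l3/loewner_window2.py`, pure python, 44 s; numbers for the 26-slot cubature word `cubatureWord`, ramp 1/2,
`T_s = 4π²|m_s|²Mτ_s`, `ϑ(1/2,T) = 1/3 − 4/T² + 12/T³ + O(e^{−T/2})`):
* class forms `G_c(q,p) = Σ_{|m_s|²=c} (τ_s/|m_s|⁴)(e_s·q)²|P_s p|²` on unit transverse pairs have the EXACT ranges `G₁ ∈ [40,60]`,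
  `G₂ ∈ [72,80]`, `G₃ ∈ [36,48]`, `G₁+G₂+G₃ ≡ 168` (extremes at `k ∥ axis` and `k ∥ face diagonal, p ∥ the other face diagonal`);
* the criterion `gainSup(lo) ≤ gainInf(hi)` holds iff (to leading order in `1/T²`, exactly in the limit `M → ∞`)
  `(hi/lo)² ≥ sup F₂ / inf F₂ = 1.46959`, `F₂ = Σ_c G_c/(|m_c|²τ_c)²`, i.e. WINDOW ASPECT `hi/lo ≥ 1.21227` (exact-ϑ bisection:
  1.21240 at M = 1, 1.21233 at M = 2, 1.21228 at M = 10) — INDEPENDENT of `M` to leading order, because obstruction (class dispersion of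
  the `−4/T_s²` corrections) and cure (their monotone rate-dependence) scale identically;
* at aspect 3/2 the margin `gainInf(hi) − gainSup(lo)` is `3.5·10⁻⁵/M²` (units of `Σ ϑ G ≈ 56`), against the cross-slot-memory scale
  `168·(1/3)/T₁³ = 1.4·10⁻⁸/M³` — the level-independent defects the two-tier caveat (ROUND-16 §E(f)) worries about fit inside the
  monotonicity margin by three orders of magnitude (`QSWindowPerturbed`);
* the FROZEN-weight model `excShape W M` is degree-(−1)-homogeneous with `excShape(I)` cubic-anisotropic by the relative amount
  `g_max/g_min − 1 = 5.655·10⁻⁷/M²` (reproducing p1's `ε_M = 5.65·10⁻⁷/M²`, r16/realised_form.py, independently): for such a map NO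
  family of NearIso windows is invariant (`HomogeneousNoWindow`, two-point obstruction `S = lo·I, hi·I`), so the package's `Φ` can be
  neither `excShape` nor any scalar normalisation of it — it must carry the rate-dependent weights (which is also what clause (V)'s
  vanishing errors force).
-/

set_option linter.dupNamespace false

namespace Summit.AnomalousDissipation.AnomalousDissipation.Cruxes.LagrangianRenormalisationStep.LoewnerWindow

open Literature.Analysis Literature.Analysis.FluidPDE Literature.Analysis.FunctionSpaces
open Summit.AnomalousDissipation.AnomalousDissipation.Theorems.SolenoidalFractalHomogenisation.LagrangianStep
open MeasureTheory Set
open scoped InnerProductSpace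

noncomputable section

/-! ## The window clause (verbatim first conjunct of `TensorCellPackage`) and shape-map vocabulary -/

/-- The WINDOW clause of `TensorCellPackage W M hM c` for a shape map `Φ` with window data `(lo, hi, Λ, β)` — its first conjunct,
verbatim (identical to `WindowClause` of the strategist's line `Cruxes/LagrangianRenormalisationStep/Lines/onelevel.lean`). -/
def WindowClause (Φ : Torus.Visc4 (Fin 3) → Torus.Visc4 (Fin 3)) (lo hi Λ β : ℝ) : Prop :=
  ∀ lam ∈ Set.Icc (1:ℝ) Λ, ∀ S : Torus.Visc4 (Fin 3), Torus.OddSmall S β → Torus.NearIso S (lo / lam) (hi * lam) →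
    Torus.OddSmall (Φ S) β ∧ Torus.NearIso (Φ S) (lo / lam) (hi * lam)

/-- Unit transverse pairs `(q, p)`: `|q| = |p| = 1`, `p ⊥ q` (the arguments on which `Torus.NearIso` constrains `Torus.symb`). -/
def transversePairs : Set ((Fin 3 → ℝ) × (Fin 3 → ℝ)) :=
  {qp | ∑ a, qp.1 a ^ 2 = 1 ∧ ∑ i, qp.2 i ^ 2 = 1 ∧ ∑ i, qp.2 i * qp.1 i = 0}

/-- Degree-(−1) homogeneity of a shape map on the isotropic ray: `Φ(σ·I) = σ⁻¹·Φ(I)` (`excShape W M` and every scalar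
normalisation of it satisfy this: `Q_s(σI) = (σP_s + m̂m̂ᵀ)⁻¹P_s = σ⁻¹P_s`). -/
def IsoHomogeneous (Φ : Torus.Visc4 (Fin 3) → Torus.Visc4 (Fin 3)) : Prop :=
  ∀ σ : ℝ, 0 < σ → Φ (σ • Torus.isoVisc 1) = σ⁻¹ • Φ (Torus.isoVisc 1)

/-- Transverse anisotropy of a tensor: two unit transverse pairs with different symbol values. -/
def TransverselyAnisotropic (𝔸 : Torus.Visc4 (Fin 3)) : Prop :=
  ∃ qp ∈ transversePairs, ∃ qp' ∈ transversePairs, Torus.symb 𝔸 qp.1 qp.2 < Torus.symb 𝔸 qp'.1 qp'.2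

/-! ## The quasi-static (rate-dependent) cell response `excQS` -/

/-- The quasi-static SLOT RESPONSE OPERATOR `f_T(B) = T ∫₀¹ a(s) ∫₀ˢ a(x) e^{−T(s−x)B} dx ds` of the unit trapezoid slot with ramp `ρ`
at non-dimensional relaxation `T`, as a matrix function of the (regularised) transverse block `B` (entrywise integrals of the matrix
exponential).  Scalar case: `f_T(x) = ϑ(ρ, T x)/x` (`slotWeight`), so `f_T(1) = ϑ(ρ, T)`; `f_T` is non-increasing and `x f_T(x)`
non-decreasing in `x > 0`. -/
def qsResp (ρ T : ℝ) (B : Matrix (Fin 3) (Fin 3) ℝ) : Matrix (Fin 3) (Fin 3) ℝ := fun i j =>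
  T * ∫ s in (0:ℝ)..1, LatticeShear.LatticeWord.trapezoid 0 1 ρ s *
    ∫ x in (0:ℝ)..s, LatticeShear.LatticeWord.trapezoid 0 1 ρ x * (NormedSpace.exp (-(T * (s - x)) • B)) i j

/-- The QUASI-STATIC EXCESS tensor of the word `W` pre-stretched by `M` at background shape `S` (per unit `1/ν²`): `excShape` with the
frozen factor `ϑ(T_s)·Q_s(S)` replaced by the rate-dependent response `f_{T_s}(B_s(S) + m̂m̂ᵀ)·P_s` (`T_s = 4π²|m_s|²Mτ_s`; at
`S = I` the two coincide). -/
def excQS {k : ℕ} (W : LatticeShear.LatticeWord k) (M : ℝ) (S : Torus.Visc4 (Fin 3)) : Torus.Visc4 (Fin 3) := fun i a j b =>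
  ∑ s, (let P := W.phase s
    let mn : ℝ := ‖Torus.latticeVec P.m‖
    let Sig : Matrix (Fin 3) (Fin 3) ℝ := fun i' j' => ∑ a', ∑ b', S i' a' j' b' * mhat P a' * mhat P b'
    let Pm : Matrix (Fin 3) (Fin 3) ℝ := fun i' j' => (if i' = j' then 1 else 0) - mhat P i' * mhat P j'
    let Q : Matrix (Fin 3) (Fin 3) ℝ := qsResp W.ramp (4 * Real.pi ^ 2 * mn ^ 2 * M * P.τ) (Pm * Sig * Pm + Matrix.vecMulVec (mhat P) (mhat P)) * Pm
    P.τ / (2 * (2 * Real.pi * mn) ^ 4) / W.period * (P.e a * P.e b) * Q i j)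

/-- Slot gain of a phase in coordinates (`= LatticeShear.slotGain P q p` for `p ⊥ q`):
`τ/(2(2π|m|)⁴) · (e·q)² · (|p|² − (p·m̂)²)`. -/
def slotGainC (P : LatticeShear.LatticePhase) (q p : Fin 3 → ℝ) : ℝ :=
  P.τ / (2 * (2 * Real.pi * ‖Torus.latticeVec P.m‖) ^ 4) * (∑ a, P.e a * q a) ^ 2 * (∑ i, p i ^ 2 - (∑ i, p i * mhat P i) ^ 2)

/-- The REALISED GAIN FORM at shape level `x > 0`: `gainForm W M x q p = Σ_s ϑ(ρ, T_s·x) · slotGain_s(q,p) / period` — the transverse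
symbol of `x · excQS W M (x·I)`; for the frozen model, `symb (excShape W M I) q p = gainForm W M 1 q p` on transverse pairs. -/
def gainForm {k : ℕ} (W : LatticeShear.LatticeWord k) (M x : ℝ) (q p : Fin 3 → ℝ) : ℝ :=
  ∑ s, slotWeight W.ramp (4 * Real.pi ^ 2 * ‖Torus.latticeVec (W.phase s).m‖ ^ 2 * M * (W.phase s).τ * x) * slotGainC (W.phase s) q p / W.period

/-- `gainSup W M x = sup` of the gain form over unit transverse pairs. -/
def gainSup {k : ℕ} (W : LatticeShear.LatticeWord k) (M x : ℝ) : ℝ := sSup ((fun qp => gainForm W M x qp.1 qp.2) '' transversePairs)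

/-- `gainInf W M x = inf` of the gain form over unit transverse pairs. -/
def gainInf {k : ℕ} (W : LatticeShear.LatticeWord k) (M x : ℝ) : ℝ := sInf ((fun qp => gainForm W M x qp.1 qp.2) '' transversePairs)

/-! ## Statements (crux idea `loewner-reflected-window`; none proved here) -/

/-- (S0, calculus; M) The realised slot weight is NON-DECREASING in the relaxation: `ϑ(ρ,T) = ∫₀¹ T e^{−Tu} C_a(u) du` with the envelope
autocorrelation `C_a` non-increasing on `[0,1]` (the trapezoid is symmetric unimodal).  Quantitatively, for ramp `1/2`:
`C_a(u) = 1/3 − 2u² + 2u³` on `[0, 1/2]`, `(2/3)(1−u)³` on `[1/2, 1]`, so `ϑ(1/2, T) = 1/3 − 4/T² + 12/T³ + O(e^{−T/2})` — the exact closed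
form is the tree's `LatticeShear.mul_integral_trapezoid_duhamel_eq`; the tree's two-sided law `abs_slotWeight_sub_le` (`|ϑ − 1/3| ≤ 4/T²`) alone
does not see the sign of the correction, which is what the window threshold S6 lives on. -/
def SlotWeightMono : Prop :=
  ∀ ρ : ℝ, 0 < ρ → ρ ≤ 1 / 2 → ∀ T T' : ℝ, 0 ≤ T → T ≤ T' → slotWeight ρ T ≤ slotWeight ρ T'

/-- (S1, the LOEWNER PINCH for the frozen model; M) For a word replayed at pre-stretch `M ≥ 0` and a background shape with symmetric
transverse blocks in the window `[a, b]`, `0 < a`: the transverse symbol of `excShape W M S` is pinched between `1/b` and `1/a` times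
that of `excShape W M I` — per slot `P_s/b ≤ [P_sΣ(S,m̂_s)P_s]⁺ ≤ P_s/a` in the Loewner order, summed with the non-negative weights
`ϑ(T_s)·τ_s/(2(2π|m_s|)⁴·period)·(e_s·q)²` (profile: 3010 random tests, 0 violations, k1l3/loewner_window2.py PART A). -/
def ExcShapePinch {k : ℕ} (W : LatticeShear.LatticeWord k) (M : ℝ) : Prop :=
  0 ≤ M → ∀ S : Torus.Visc4 (Fin 3), ∀ a b : ℝ, 0 < a → a ≤ b → Torus.OddSmall S 0 → Torus.NearIso S a b →
    ∀ qp ∈ transversePairs,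
      Torus.symb (excShape W M (Torus.isoVisc 1)) qp.1 qp.2 / b ≤ Torus.symb (excShape W M S) qp.1 qp.2 ∧
      Torus.symb (excShape W M S) qp.1 qp.2 ≤ Torus.symb (excShape W M (Torus.isoVisc 1)) qp.1 qp.2 / a

/-- (S2, the LOEWNER PINCH for the quasi-static response; M given S0) Same with rate-dependent weights: `f_{T_s}` non-increasing and
`x f_{T_s}(x) = ϑ(T_s x)` non-decreasing give `gainForm(b)/b ≤ symb (excQS S) ≤ gainForm(a)/a` on unit transverse pairs, and `excQS S`
has symmetric transverse blocks again (`OddSmall _ 0` is preserved: single-layer responses `e_s ⊗ e_s ⊗ f(B_s)` with `f(B_s)` symmetric). -/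
def QSPinch {k : ℕ} (W : LatticeShear.LatticeWord k) (M : ℝ) : Prop :=
  0 ≤ M → ∀ S : Torus.Visc4 (Fin 3), ∀ a b : ℝ, 0 < a → a ≤ b → Torus.OddSmall S 0 → Torus.NearIso S a b →
    Torus.OddSmall (excQS W M S) 0 ∧
    ∀ qp ∈ transversePairs,
      gainForm W M b qp.1 qp.2 / b ≤ Torus.symb (excQS W M S) qp.1 qp.2 ∧
      Torus.symb (excQS W M S) qp.1 qp.2 ≤ gainForm W M a qp.1 qp.2 / a

/-- (S3, THE WINDOW THEOREM; S given S0–S2) If the two explicit quartic-form extremes satisfy `gainSup(lo) ≤ N·lo·hi ≤ gainInf(hi)` then the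
normalised quasi-static map `N⁻¹·excQS W M` satisfies the window clause of `TensorCellPackage` with window `(lo, hi)`, EVERY `Λ ≥ 1`
and `β = 0`: for `λ ≥ 1`, `symb ≤ N⁻¹ gainSup(lo/λ)·λ/lo ≤ N⁻¹ gainSup(lo)·λ/lo ≤ hi·λ` and `symb ≥ N⁻¹ gainInf(hi·λ)/(hi·λ) ≥ lo/λ`
(monotonicity of `gainSup`, `gainInf` in the level from S0).  No smallness, no linearisation, no contraction of anisotropy. -/
def QSWindow {k : ℕ} (W : LatticeShear.LatticeWord k) (M : ℝ) : Prop :=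
  0 < M → ∀ lo hi N : ℝ, 0 < lo → lo ≤ hi → gainSup W M lo ≤ N * lo * hi → N * lo * hi ≤ gainInf W M hi →
    ∀ Λ : ℝ, 1 ≤ Λ → WindowClause (fun S => N⁻¹ • excQS W M S) lo hi Λ 0

/-- (S3′, robustness = the two-tier caveat made quantitative; S given S2) Any shape map `Φ` that keeps transverse blocks symmetric and is
RELATIVELY `η`-close to the normalised quasi-static response on unit transverse pairs (`|symb (Φ S) − symb (N⁻¹ excQS S)| ≤ η · symb (N⁻¹ excQS S)`;
cross-slot memory and dressing corrections are `O(T_s⁻³)` relative) satisfies the window clause as soon as the margin absorbs `η`: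
`(1+η)·gainSup(lo) ≤ N·lo·hi ≤ (1−η)·gainInf(hi)` (profile: at aspect 3/2 the margin is `3.5·10⁻⁵/M²` of `N·lo·hi ≈ 56`, the memory
scale `1.4·10⁻⁸/M³`). -/
def QSWindowPerturbed {k : ℕ} (W : LatticeShear.LatticeWord k) (M : ℝ) : Prop :=
  0 < M → QSPinch W M → ∀ (Φ : Torus.Visc4 (Fin 3) → Torus.Visc4 (Fin 3)) (lo hi N η Λ : ℝ),
    0 < lo → lo ≤ hi → 0 < N → 0 ≤ η → η < 1 → 1 ≤ Λ →
    (∀ S : Torus.Visc4 (Fin 3), Torus.OddSmall S 0 → Torus.OddSmall (Φ S) 0 ∧ ∀ qp ∈ transversePairs,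
        |Torus.symb (Φ S) qp.1 qp.2 - Torus.symb (N⁻¹ • excQS W M S) qp.1 qp.2| ≤ η * Torus.symb (N⁻¹ • excQS W M S) qp.1 qp.2) →
    (1 + η) * gainSup W M lo ≤ N * lo * hi → N * lo * hi ≤ (1 - η) * gainInf W M hi →
    WindowClause Φ lo hi Λ 0

/-- (S4, the OBSTRUCTION; S) A shape map that is degree-(−1)-homogeneous on the isotropic ray and transversally ANISOTROPIC at `I` has NO
invariant NearIso window containing the isotropic shape: `S = lo·I` forces `sup symb Φ(I) ≤ lo·hi`, `S = hi·I` forces `inf symb Φ(I) ≥ lo·hi`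
(both test shapes have zero odd part, so every `β ≥ 0` is covered). -/
def HomogeneousNoWindow : Prop :=
  ∀ Φ : Torus.Visc4 (Fin 3) → Torus.Visc4 (Fin 3), IsoHomogeneous Φ → TransverselyAnisotropic (Φ (Torus.isoVisc 1)) →
    ∀ lo hi Λ β : ℝ, 0 < lo → lo ≤ 1 → 1 ≤ hi → 1 ≤ Λ → 0 ≤ β → ¬ WindowClause Φ lo hi Λ β

/-- (S5, the frozen model is anisotropic at every finite pre-stretch; M given strict S0) For the cubature word of record, `excShape W M I` is
transversally anisotropic for every `M > 0`: the three relaxation classes `|m|²τ = 40, 256, 729` get pairwise DIFFERENT weights `ϑ(T_c)`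
(`ϑ` strictly increasing) and no single class form `G_c` is isotropic (`G₁ ∈ [40,60]`, `G₂ ∈ [72,80]`, `G₃ ∈ [36,48]`); the relative anisotropy is
`g_max/g_min − 1 = 5.655·10⁻⁷/M²` (= p1's `ε_M`).  With S4: `¬ WindowClause (N⁻¹ • excShape cubatureWord M ·) lo hi Λ β` for all admissible data —
the package's `Φ` cannot be the frozen model. -/
def CubatureExcShapeNoWindow : Prop :=
  ∀ M : ℝ, 0 < M → TransverselyAnisotropic (excShape Theorems.cubatureWord M (Torus.isoVisc 1)) ∧
    ∀ N lo hi Λ β : ℝ, 0 < N → 0 < lo → lo ≤ 1 → 1 ≤ hi → 1 ≤ Λ → 0 ≤ β →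
      ¬ WindowClause (fun S => N⁻¹ • excShape Theorems.cubatureWord M S) lo hi Λ β

/-- (S6, the CERTIFIED THRESHOLD for the cubature word; M, finite-dimensional) For every pre-stretch `M ≥ 1` and every window with `lo ≥ 1/2` and
aspect `hi/lo ≥ 3/2` the criterion of S3 is met with room: `gainSup(lo) < gainInf(hi)`.  PROFILE: the sharp aspect is `1.21240` at `M = 1`
(`1.21233`, `1.21229`, `1.21228` at `M = 2, 5, 10`; leading order `√(sup F₂/inf F₂) = √1.469588 = 1.212266`); at aspect `3/2` the leading balance
reads `(hi/lo)² = 2.25 > 1.4696 = 280560927/190911238` (exact), so a certificate needs only the AXIS-CLASS form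
`G₁(q,p) = 40·(1 + Σ_a q_a²p_a²) ∈ [40, 60]` on unit transverse pairs (even the Bessel bound `Σ_a q_a²p_a² ≤ 2/3` suffices) with `G₂+G₃ = 168−G₁`,
the class relaxations `T₂ = 6.4·T₁`, `T₃ = 18.2·T₁`, `T₁ = 4π²·40·M·x ≥ 789` on `x ≥ 1/2`, and the exact closed form of `ϑ`
(`mul_integral_trapezoid_duhamel_eq`: `ϑ(1/2,T) = 1/3 − 4/T² + 12/T³ ± O(e^{−T/2})`) — interval arithmetic, no optimisation.  (Restricting to
`lo ≥ 1/2` keeps every relaxation `T_s·x` saturated; for `lo → 0` the small-`T` crossover has its own, uncomputed threshold, which S3 never needs: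
levels below `lo` enter S3 only through monotonicity.)  Consequently S3 applies with any `N ∈ [gainSup(lo)/(lo·hi), gainInf(hi)/(lo·hi)]`, e.g. on
the window `[√(2/3), √(3/2)] ∋ 1`. -/
def CubatureThreshold : Prop :=
  ∀ M : ℝ, 1 ≤ M → ∀ lo hi : ℝ, 1 / 2 ≤ lo → 3 / 2 * lo ≤ hi →
    gainSup Theorems.cubatureWord M lo < gainInf Theorems.cubatureWord M hi

/-- (S7, ASSEMBLY of the idea for the window half of `stub_cellLawV` / `stub_cellLawT`; S given S3, S6) For the cubature word and every `M ≥ 1`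
there are an explicit shape map (`N⁻¹·excQS`), a window `lo ≤ 1 ≤ hi` and `β = 0` such that the window clause of `TensorCellPackage` holds for
EVERY `Λ > 1` — the first conjunct of the package, discharged by finite-dimensional monotonicity alone. -/
def CubatureWindowClause : Prop :=
  ∀ M : ℝ, 1 ≤ M → ∃ N > (0:ℝ), ∃ lo > (0:ℝ), ∃ hi : ℝ, lo ≤ 1 ∧ 1 ≤ hi ∧
    ∀ Λ : ℝ, 1 < Λ → WindowClause (fun S => N⁻¹ • excQS Theorems.cubatureWord M S) lo hi Λ 0

end

end Summit.AnomalousDissipation.AnomalousDissipation.Cruxes.LagrangianRenormalisationStep.LoewnerWindow
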